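import Summits.NavierStokesRegularity.FunctionalMining.VelocityL4SaturatingLaw
import Summits.NavierStokesRegularity.FunctionalMining.SaturatingLawLyapunov

/-!
# Row `EK.EV.s=4|T_M0`: the `L⁴` velocity-moment Lyapunov functional

Search for candidate a priori estimates; no regularity claim.

The K0 matrix books the row `EK.EV.s=4|T_M0` (`M(κ) = K − κ⁻¹ ν⁶ U₄⁻¹`, `U₄ = ∫‖u‖⁴`,
`K = ½‖u‖₂²`) as "HOLDS ∃κ (inherited)" from the saturating-law row `EV.s=4|T_LD|G1`. That row is
the tree theorem `VelocityL4.velocityL4_saturatingLaw` (`σ = 1, γ = 5`), and the inheritance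
`T_LD ⟹ T_M0` is `SaturatingLaw.antitoneOn_lyapunov`; this file composes them: there is `κ > 0`
such that along every zero-mean classical solution of unforced Navier–Stokes on `T³ × [a, b]` with
`∫‖u t‖⁴ > 0` on the window, `t ↦ K(u t) − κ⁻¹ν⁶/U₄(u t)` is antitone.

## Main statements

* `VelocityL4.lyapunov_antitoneOn` — row `EK.EV.s=4|T_M0` on positive-`U₄` windows.
-/

noncomputable section

open MeasureTheory Set

namespace Summit.NavierStokesRegularity.FunctionalMining

open Literature.Analysis.FunctionSpaces Literature.Analysis.FluidPDE

variable {d : Type*} [Fintype d] [DecidableEq d]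

/-- **Row `EK.EV.s=4|T_M0` (kernel).** There is `κ > 0` such that along every zero-mean classical
solution of unforced Navier–Stokes on `T³ × [a, b]` with `∫‖u t‖⁴ > 0` on the window,
`t ↦ K(u t) − κ⁻¹ ν⁶ (∫‖u t‖⁴)⁻¹` is antitone on `[a, b]` — from `velocityL4_saturatingLaw`
(`σ = 1, γ = 5`) and `SaturatingLaw.antitoneOn_lyapunov`. Search for candidate a priori estimates;
no regularity claim. [folklore] -/
theorem VelocityL4.lyapunov_antitoneOn :
    ∃ κ : ℝ, 0 < κ ∧ ∀ (_ : Fintype.card d = 3) {ν a b : ℝ}, 0 < ν → a < b →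
      ∀ {u : ℝ → UnitAddTorus d → EuclideanSpace ℝ d} {p : ℝ → UnitAddTorus d → ℝ},
        Torus.IsClassicalNSSolutionOn (Icc a b) ν 0 u p →
        (∀ t ∈ Icc a b, Torus.HasZeroMean (u t)) →
        (∀ t ∈ Icc a b, 0 < ∫ x, ‖u t x‖ ^ 4) →
        AntitoneOn (fun t => Torus.kineticEnergy (u t) - κ⁻¹ * ν ^ (6 : ℝ) * (∫ x, ‖u t x‖ ^ 4)⁻¹)
          (Icc a b) := by
  obtain ⟨κ₀, hκ₀⟩ := VelocityL4.velocityL4_saturatingLaw (d := d)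
  have hF0 : ∀ v : UnitAddTorus d → EuclideanSpace ℝ d, 0 ≤ ∫ x, ‖v x‖ ^ 4 :=
    fun v => integral_nonneg fun x => by positivity
  have hlaw : SaturatingLaw (d := d) (fun v => ∫ x, ‖v x‖ ^ 4) 1 5 (max κ₀ 1) :=
    hκ₀.mono_kappa hF0 (le_max_left _ _)
  have hκ : 0 < max κ₀ 1 := lt_of_lt_of_le one_pos (le_max_right _ _)
  refine ⟨max κ₀ 1, hκ, fun hd ν a b hν hab u p hsol hmean hpos => ?_⟩
  have h := hlaw.antitoneOn_lyapunov one_pos hκ hd hν hab hsol hmean hpos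
  have hγ : (5 : ℝ) + 1 = 6 := by norm_num
  refine h.congr fun t ht => ?_
  simp only [hγ, inv_one, Real.rpow_neg_one, one_div]

end Summit.NavierStokesRegularity.FunctionalMining
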